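/-
Copyright (c) 2026 the pub-hodgecm-mathlib formalisation cell (harness21).  Prover seat hodgecm-mathlib-K2Liu-p10 (g0), Track B «K2-LIT»,
#184♮ = hLiu418 = `stmt-HodgeConjecture-24832`; LEAD F0P6-plan (g12) 06:48:17Z ∕ 07:08:11Z «= NEXT H1-C», SIGS-RoadI-v3 §Hol row H1-C
(K2E5-plan (g5)).  THEOREMS ONLY (no `def`, no `instance`, no named-fact hypothesis, no `sorry`).
-/
import Summits.HodgeConjecture.HodgeConjecture.Theorems.K2LiuHermitianTubeCocycle
import HarnessLib

/-!
# Crux `HLiu418`, Road I, organ Hol-1 (H1-C), ring level: the FRAME `T` carrying the doubled form `diag(t) ⊕ −diag(t)` (`t` real,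
# nowhere zero, any signs) to the tube form `i·J`, the Siegel parabolic `P_Δ = Stab{(x,x)}` to `{C = 0}`, and `N_Δ` onto the
# hermitian translations

Cell `hodgecm-mathlib`, crux item hLiu418 = `stmt-HodgeConjecture-24832` (helper lane, count-neutral).  At a complex place `w` of the
CM field the doubled hermitian form `J^𝔻 = 𝕁 ⊕ −𝕁` (★ `hermD_eq_reindex`) becomes `H_w = diag(t) ⊕ −diag(t)` with `t : l → ℝ`,
`t_i ≠ 0` of either sign.  With `d_i = √(|t_i|/2)`, `e_i = t_i/|t_i|` and the diagonal matrices `D = diag(d)`, `C₀ = diag(i e d)`,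
`P₀ = diag(d⁻¹/2)`, `P₁ = diag(i d⁻¹ e/2)` put
  `T = (D D; C₀ −C₀)`,   `T⁻¹ = (P₀ −P₁; P₀ P₁)`.
THIS FILE PROVES (all by block algebra + entrywise real arithmetic; the frame is carried BY VALUE — every transport lemma is stated
for block letters `D, C₀, P₀, P₁` under the four relations (R1) `DP₀ + DP₀ = 1`, (R2) `C₀P₁ + C₀P₁ = −1`, (R3) `P₀D − P₁C₀ = 1`,
(R4) `P₀D + P₁C₀ = 0`, and §3 shows the diagonal letters satisfy them):
* §1 `T T⁻¹ = 1 = T⁻¹ T` (from (R1)–(R4)); form transport `(TgT⁻¹)ᴴ K (TgT⁻¹) = K` whenever `Tᴴ K T = H`, `gᴴ H g = H`;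
* §2 SIEGEL: if `g = (a b; c d)` preserves `Δ = {(x,x)}` (`a + b = c + d`, ★ `IsSiegelM`'s block equation) then `(T g T⁻¹)₂₁ = 0`;
  UNIPOTENT: `N_Δ` consists of `u(φ) = (1+φ −φ; φ 1−φ)` (★ `IsUnipM`'s three block equations ⇔ this shape) and
  `T u(φ) T⁻¹ = (1 b; 0 1)` with `b = −4·DφP₁`;
* §3 the explicit letters: (R1)–(R4), `Tᴴ (i·J) T = diag(t) ⊕ −diag(t)`, `b` is HERMITIAN iff `diag(t)φ` is skew-hermitian (the
  unitarity condition of `u(φ)` for `H_w`), and conversely every hermitian `b` is reached (`φ = −(2i)⁻¹ D⁻¹ b E D`): `N_Δ(ℝ_w) ≃ Herm_l(ℂ)`;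
* §4 the PACKAGE `exists_tubeFrame` (one existential with all of the above) — what H1-E ∕ the Hol.3(c) assembly consume per place.
Sources: [Shimura1997, §§5–6 (Case UT)].  HONEST LABEL.  Helper lemmas, count-neutral; `HC_CM` is proved only modulo the 7 printed
citations (2 remaining named inputs: hLiu418 = `stmt-HodgeConjecture-24832`, h413 = `stmt-HodgeConjecture-24833`) until rung 0 closes.
-/

set_option autoImplicit false
set_option linter.dupNamespace false -- the mandated namespace repeats `HodgeConjecture.HodgeConjecture`

namespace Summit.HodgeConjecture.HodgeConjecture.Cruxes.HLiu418.K2LiuHermitianTubeFrame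

open Matrix Complex
open scoped MatrixGroups ComplexConjugate
open K2LiuHermitianTubeCocycle

variable {l : Type*} [Fintype l] [DecidableEq l]

/-! ## 1. Block letters: `T T⁻¹ = 1`, `T⁻¹ T = 1`, form transport -/

/-- `T T⁻¹ = 1` for `T = (D D; C₀ −C₀)`, `T⁻¹ = (P₀ −P₁; P₀ P₁)` under (R1) `DP₀ + DP₀ = 1`, (R2) `C₀P₁ + C₀P₁ = −1`. [cite: Shimura1997, §6] -/
theorem frame_mul_frameInv {D C₀ P₀ P₁ : Matrix l l ℂ} (h1 : D * P₀ + D * P₀ = 1) (h2 : C₀ * P₁ + C₀ * P₁ = -1) :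
    fromBlocks D D C₀ (-C₀) * fromBlocks P₀ (-P₁) P₀ P₁ = 1 := by
  rw [fromBlocks_multiply, ← fromBlocks_one, fromBlocks_inj]
  refine ⟨h1, ?_, ?_, ?_⟩
  · rw [Matrix.mul_neg, neg_add_cancel]
  · rw [Matrix.neg_mul, add_neg_cancel]
  · rw [Matrix.mul_neg, Matrix.neg_mul, ← neg_add, h2, neg_neg]

/-- `T⁻¹ T = 1` under (R3) `P₀D − P₁C₀ = 1`, (R4) `P₀D + P₁C₀ = 0`. [cite: Shimura1997, §6] -/
theorem frameInv_mul_frame {D C₀ P₀ P₁ : Matrix l l ℂ} (h3 : P₀ * D - P₁ * C₀ = 1) (h4 : P₀ * D + P₁ * C₀ = 0) :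
    fromBlocks P₀ (-P₁) P₀ P₁ * fromBlocks D D C₀ (-C₀) = 1 := by
  rw [fromBlocks_multiply, ← fromBlocks_one, fromBlocks_inj]
  refine ⟨?_, ?_, h4, ?_⟩
  · rw [Matrix.neg_mul, ← sub_eq_add_neg, h3]
  · rw [Matrix.neg_mul, Matrix.mul_neg, neg_neg, h4]
  · rw [Matrix.mul_neg, ← sub_eq_add_neg, h3]

/-- **Form transport** (matrix level): if `Tᴴ K T = H`, `T T' = 1` and `gᴴ H g = H` then `(T g T')ᴴ K (T g T') = K`.
[cite: Shimura1997, §5.1] -/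
theorem conjTranspose_conj_mul_mul_conj {m : Type*} [Fintype m] [DecidableEq m] {T T' K H g : Matrix m m ℂ} (hT : Tᴴ * K * T = H)
    (h1 : T * T' = 1) (hg : gᴴ * H * g = H) : (T * g * T')ᴴ * K * (T * g * T') = K := by
  have hK : K = T'ᴴ * H * T' := by
    rw [← hT]
    calc K = (T * T')ᴴ * K * (T * T') := by rw [h1, conjTranspose_one, Matrix.one_mul, Matrix.mul_one]
      _ = T'ᴴ * (Tᴴ * K * T) * T' := by rw [conjTranspose_mul]; simp only [Matrix.mul_assoc]
  rw [conjTranspose_mul, conjTranspose_mul]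
  calc T'ᴴ * (gᴴ * Tᴴ) * K * (T * g * T') = T'ᴴ * (gᴴ * (Tᴴ * K * T) * g) * T' := by simp only [Matrix.mul_assoc]
    _ = K := by rw [hT, hg, ← hK]

/-- Form transport into `U(J)`-currency: if `Tᴴ (i·J) T = H`, `T T' = 1`, `gᴴ H g = H` then `(TgT')ᴴ J (TgT') = J`.
[cite: Shimura1997, §5.1] -/
theorem conj_mem_UJ {T T' H g : Matrix (l ⊕ l) (l ⊕ l) ℂ} (hT : Tᴴ * (I • Matrix.J l ℂ) * T = H) (h1 : T * T' = 1)
    (hg : gᴴ * H * g = H) : (T * g * T')ᴴ * Matrix.J l ℂ * (T * g * T') = Matrix.J l ℂ := by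
  have h := conjTranspose_conj_mul_mul_conj hT h1 hg
  rw [Matrix.mul_smul, Matrix.smul_mul] at h
  exact smul_right_injective (Matrix (l ⊕ l) (l ⊕ l) ℂ) I_ne_zero h

/-! ## 2. Siegel elements go to `{C = 0}`, unipotents to translations -/

/-- **`P_Δ ↦ {C = 0}`**: if `g` preserves `Δ = {(x,x)}`, i.e. `g₁₁ + g₁₂ = g₂₁ + g₂₂`, then `T g T⁻¹` has vanishing lower-left block.
[cite: Shimura1997, §6.4] -/
theorem toBlocks₂₁_conj_eq_zero_of_siegel (D C₀ P₀ P₁ : Matrix l l ℂ) {g : Matrix (l ⊕ l) (l ⊕ l) ℂ}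
    (hg : g.toBlocks₁₁ + g.toBlocks₁₂ = g.toBlocks₂₁ + g.toBlocks₂₂) :
    (fromBlocks D D C₀ (-C₀) * g * fromBlocks P₀ (-P₁) P₀ P₁).toBlocks₂₁ = 0 := by
  set a := g.toBlocks₁₁; set b := g.toBlocks₁₂; set c := g.toBlocks₂₁; set d := g.toBlocks₂₂
  have hge : g = fromBlocks a b c d := (fromBlocks_toBlocks g).symm
  have h0 : a + b - (c + d) = 0 := sub_eq_zero.2 hg
  rw [hge, fromBlocks_multiply, fromBlocks_multiply, toBlocks_fromBlocks₂₁]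
  calc (C₀ * a + -C₀ * c) * P₀ + (C₀ * b + -C₀ * d) * P₀ = C₀ * (a + b - (c + d)) * P₀ := by noncomm_ring
    _ = 0 := by rw [h0, Matrix.mul_zero, Matrix.zero_mul]

omit [Fintype l] in
/-- **`N_Δ`'s shape**: the three block equations of ★ `IsUnipM` (`u₁₁ + u₁₂ = 1`, `u₂₁ + u₂₂ = 1`, `u₂₂ − u₁₂ = 1`) hold iff
`u = (1+φ −φ; φ 1−φ)` with `φ = u₂₁`. [cite: Shimura1997, §6.4] -/
theorem isUnip_blocks_iff (u : Matrix (l ⊕ l) (l ⊕ l) ℂ) :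
    (u.toBlocks₁₁ + u.toBlocks₁₂ = 1 ∧ u.toBlocks₂₁ + u.toBlocks₂₂ = 1 ∧ u.toBlocks₂₂ - u.toBlocks₁₂ = 1) ↔
      u = fromBlocks (1 + u.toBlocks₂₁) (-u.toBlocks₂₁) u.toBlocks₂₁ (1 - u.toBlocks₂₁) := by
  constructor
  · rintro ⟨h1, h2, h3⟩
    have hd : u.toBlocks₂₂ = 1 - u.toBlocks₂₁ := by rw [← h2]; abel
    have hb : u.toBlocks₁₂ = -u.toBlocks₂₁ := by
      rw [hd, sub_sub, sub_eq_self] at h3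
      exact eq_neg_of_add_eq_zero_right h3
    have ha : u.toBlocks₁₁ = 1 + u.toBlocks₂₁ := by
      rw [hb, ← sub_eq_add_neg, sub_eq_iff_eq_add] at h1
      exact h1
    conv_lhs => rw [← fromBlocks_toBlocks u]
    rw [ha, hb, hd]
  · intro h
    have h11 : u.toBlocks₁₁ = 1 + u.toBlocks₂₁ := by
      have := congrArg Matrix.toBlocks₁₁ h; rwa [toBlocks_fromBlocks₁₁] at this
    have h12 : u.toBlocks₁₂ = -u.toBlocks₂₁ := by
      have := congrArg Matrix.toBlocks₁₂ h; rwa [toBlocks_fromBlocks₁₂] at this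
    have h22 : u.toBlocks₂₂ = 1 - u.toBlocks₂₁ := by
      have := congrArg Matrix.toBlocks₂₂ h; rwa [toBlocks_fromBlocks₂₂] at this
    rw [h11, h12, h22]
    refine ⟨?_, ?_, ?_⟩ <;> abel

/-- **`N_Δ ↦ translations`**: `T u(φ) T⁻¹ = (1 b; 0 1)` with `b = −((D + Dφ + Dφ) P₁) + (D − Dφ − Dφ) P₁` (`= −4·DφP₁`), under (R1), (R2).
[cite: Shimura1997, §6.4] -/
theorem conj_unip_eq_transl {D C₀ P₀ P₁ : Matrix l l ℂ} (h1 : D * P₀ + D * P₀ = 1) (h2 : C₀ * P₁ + C₀ * P₁ = -1)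
    (φ : Matrix l l ℂ) :
    fromBlocks D D C₀ (-C₀) * fromBlocks (1 + φ) (-φ) φ (1 - φ) * fromBlocks P₀ (-P₁) P₀ P₁ =
      fromBlocks 1 (-(D * φ * P₁ + D * φ * P₁ + (D * φ * P₁ + D * φ * P₁))) 0 1 := by
  rw [fromBlocks_multiply, fromBlocks_multiply]
  congr 1
  · calc (D * (1 + φ) + D * φ) * P₀ + (D * -φ + D * (1 - φ)) * P₀ = D * P₀ + D * P₀ := by noncomm_ring
      _ = 1 := h1
  · noncomm_ring
  · noncomm_ring
  · calc (C₀ * (1 + φ) + -C₀ * φ) * -P₁ + (C₀ * -φ + -C₀ * (1 - φ)) * P₁ = -(C₀ * P₁ + C₀ * P₁) := by noncomm_ring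
      _ = 1 := by rw [h2, neg_neg]

/-! ## 3. The diagonal letters: `D = diag(d)`, `C₀ = diag(i e d)`, `P₀ = diag(d⁻¹/2)`, `P₁ = diag(i d⁻¹ e/2)` with real `d ≠ 0`,
`e² = 1`, `2 e d² = t` -/

section Letters

variable (d e : l → ℝ)

/-- (R1) `D P₀ + D P₀ = 1`. [cite: Shimura1997, §6] -/
theorem letters_R1 (hd : ∀ i, d i ≠ 0) :
    diagonal (fun i => (d i : ℂ)) * diagonal (fun i => (((d i)⁻¹ / 2 : ℝ) : ℂ)) +
      diagonal (fun i => (d i : ℂ)) * diagonal (fun i => (((d i)⁻¹ / 2 : ℝ) : ℂ)) = 1 := by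
  rw [diagonal_mul_diagonal, diagonal_add, ← diagonal_one]
  refine congrArg diagonal (funext fun i => ?_)
  have hd' : (d i : ℂ) ≠ 0 := ofReal_ne_zero.2 (hd i)
  push_cast
  field_simp
  ring

/-- (R2) `C₀ P₁ + C₀ P₁ = −1`. [cite: Shimura1997, §6] -/
theorem letters_R2 (hd : ∀ i, d i ≠ 0) (he : ∀ i, e i * e i = 1) :
    diagonal (fun i => I * ((e i * d i : ℝ) : ℂ)) * diagonal (fun i => I * (((d i)⁻¹ * e i / 2 : ℝ) : ℂ)) +
      diagonal (fun i => I * ((e i * d i : ℝ) : ℂ)) * diagonal (fun i => I * (((d i)⁻¹ * e i / 2 : ℝ) : ℂ)) = -1 := by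
  rw [diagonal_mul_diagonal, diagonal_add, ← diagonal_one, diagonal_neg]
  refine congrArg diagonal (funext fun i => ?_)
  have hd' : (d i : ℂ) ≠ 0 := ofReal_ne_zero.2 (hd i)
  have he' : (e i : ℂ) * (e i : ℂ) = 1 := by exact_mod_cast he i
  have key : I * ((e i * d i : ℝ) : ℂ) * (I * (((d i)⁻¹ * e i / 2 : ℝ) : ℂ)) =
      (I * I) * ((e i : ℂ) * (e i : ℂ)) * ((d i : ℂ) * (d i : ℂ)⁻¹) / 2 := by
    push_cast; ring
  rw [key, I_mul_I, he', mul_inv_cancel₀ hd']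
  ring

/-- (R3) `P₀ D − P₁ C₀ = 1`. [cite: Shimura1997, §6] -/
theorem letters_R3 (hd : ∀ i, d i ≠ 0) (he : ∀ i, e i * e i = 1) :
    diagonal (fun i => (((d i)⁻¹ / 2 : ℝ) : ℂ)) * diagonal (fun i => (d i : ℂ)) -
      diagonal (fun i => I * (((d i)⁻¹ * e i / 2 : ℝ) : ℂ)) * diagonal (fun i => I * ((e i * d i : ℝ) : ℂ)) = 1 := by
  rw [diagonal_mul_diagonal, diagonal_mul_diagonal, diagonal_sub, ← diagonal_one]
  refine congrArg diagonal (funext fun i => ?_)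
  have hd' : (d i : ℂ) ≠ 0 := ofReal_ne_zero.2 (hd i)
  have he' : (e i : ℂ) * (e i : ℂ) = 1 := by exact_mod_cast he i
  have key : (((d i)⁻¹ / 2 : ℝ) : ℂ) * (d i : ℂ) - I * (((d i)⁻¹ * e i / 2 : ℝ) : ℂ) * (I * ((e i * d i : ℝ) : ℂ)) =
      ((d i : ℂ)⁻¹ * (d i : ℂ)) * (1 - (I * I) * ((e i : ℂ) * (e i : ℂ))) / 2 := by
    push_cast; ring
  rw [key, I_mul_I, he', inv_mul_cancel₀ hd']
  ring

/-- (R4) `P₀ D + P₁ C₀ = 0`. [cite: Shimura1997, §6] -/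
theorem letters_R4 (hd : ∀ i, d i ≠ 0) (he : ∀ i, e i * e i = 1) :
    diagonal (fun i => (((d i)⁻¹ / 2 : ℝ) : ℂ)) * diagonal (fun i => (d i : ℂ)) +
      diagonal (fun i => I * (((d i)⁻¹ * e i / 2 : ℝ) : ℂ)) * diagonal (fun i => I * ((e i * d i : ℝ) : ℂ)) = 0 := by
  rw [diagonal_mul_diagonal, diagonal_mul_diagonal, diagonal_add, ← diagonal_zero]
  refine congrArg diagonal (funext fun i => ?_)
  have hd' : (d i : ℂ) ≠ 0 := ofReal_ne_zero.2 (hd i)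
  have he' : (e i : ℂ) * (e i : ℂ) = 1 := by exact_mod_cast he i
  have key : (((d i)⁻¹ / 2 : ℝ) : ℂ) * (d i : ℂ) + I * (((d i)⁻¹ * e i / 2 : ℝ) : ℂ) * (I * ((e i * d i : ℝ) : ℂ)) =
      ((d i : ℂ)⁻¹ * (d i : ℂ)) * (1 + (I * I) * ((e i : ℂ) * (e i : ℂ))) / 2 := by
    push_cast; ring
  rw [key, I_mul_I, he', inv_mul_cancel₀ hd']
  ring

/-- **`Tᴴ (i·J) T = diag(t) ⊕ −diag(t)`** for the letters, `t = 2 e d²`. [cite: Shimura1997, §6] -/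
theorem frame_conjTranspose_mul_smul_J_mul (t : l → ℝ) (ht : ∀ i, 2 * e i * d i * d i = t i) :
    (fromBlocks (diagonal (fun i => (d i : ℂ))) (diagonal (fun i => (d i : ℂ)))
        (diagonal (fun i => I * ((e i * d i : ℝ) : ℂ))) (-diagonal (fun i => I * ((e i * d i : ℝ) : ℂ))))ᴴ *
      (I • Matrix.J l ℂ) *
      fromBlocks (diagonal (fun i => (d i : ℂ))) (diagonal (fun i => (d i : ℂ)))
        (diagonal (fun i => I * ((e i * d i : ℝ) : ℂ))) (-diagonal (fun i => I * ((e i * d i : ℝ) : ℂ))) =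
      fromBlocks (diagonal fun i => (t i : ℂ)) 0 0 (-diagonal fun i => (t i : ℂ)) := by
  have hc : ∀ i, (starRingEnd ℂ) (I * ((e i * d i : ℝ) : ℂ)) = -(I * ((e i * d i : ℝ) : ℂ)) := by
    intro i; rw [map_mul, conj_I, conj_ofReal, neg_mul]
  have hdc : ∀ i, (starRingEnd ℂ) ((d i : ℝ) : ℂ) = ((d i : ℝ) : ℂ) := fun i => conj_ofReal _
  have ht' : ∀ i, I * (-(I * ((e i * d i : ℝ) : ℂ)) * (d i : ℂ) - (d i : ℂ) * (I * ((e i * d i : ℝ) : ℂ))) = (t i : ℂ) := by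
    intro i
    rw [← ht i]
    have h1 : I * (-(I * ((e i * d i : ℝ) : ℂ)) * (d i : ℂ) - (d i : ℂ) * (I * ((e i * d i : ℝ) : ℂ))) =
        -(I * I) * (2 * (e i : ℂ) * (d i : ℂ) * (d i : ℂ)) := by
      push_cast; ring
    rw [h1, I_mul_I]
    push_cast; ring
  rw [Matrix.mul_smul, Matrix.smul_mul, fromBlocks_conjTranspose_mul_J_mul, fromBlocks_smul, fromBlocks_inj]
  simp only [diagonal_conjTranspose, diagonal_mul_diagonal, diagonal_sub, diagonal_neg, ← diagonal_smul, Pi.star_apply,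
    RCLike.star_def, hc, hdc, map_neg, neg_neg]
  refine ⟨congrArg diagonal (funext fun i => ?_), ?_, ?_, congrArg diagonal (funext fun i => ?_)⟩
  · simp only [Pi.smul_apply, smul_eq_mul]
    rw [← ht' i]
  · rw [← diagonal_zero]
    refine congrArg diagonal (funext fun i => ?_)
    simp only [Pi.smul_apply, smul_eq_mul]
    ring
  · rw [← diagonal_zero]
    refine congrArg diagonal (funext fun i => ?_)
    simp only [Pi.smul_apply, smul_eq_mul]
    ring
  · simp only [Pi.smul_apply, smul_eq_mul]
    rw [← ht' i]
    ring

/-- **The translation `b = −4·DφP₁` is HERMITIAN when `diag(t)φ` is skew-hermitian** (the unitarity condition of `u(φ)` w.r.t.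
`diag(t) ⊕ −diag(t)`), `t = 2 e d²`, `d ≠ 0`, `e² = 1`. [cite: Shimura1997, §6.4] -/
theorem conjTranspose_transl_of_skew (hd : ∀ i, d i ≠ 0) (he : ∀ i, e i * e i = 1) (t : l → ℝ)
    (ht : ∀ i, 2 * e i * d i * d i = t i) {φ : Matrix l l ℂ}
    (hφ : (diagonal (fun i => (t i : ℂ)) * φ)ᴴ = -(diagonal (fun i => (t i : ℂ)) * φ)) :
    (diagonal (fun i => (d i : ℂ)) * φ * diagonal (fun i => I * (((d i)⁻¹ * e i / 2 : ℝ) : ℂ)))ᴴ =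
      diagonal (fun i => (d i : ℂ)) * φ * diagonal (fun i => I * (((d i)⁻¹ * e i / 2 : ℝ) : ℂ)) := by
  ext i j
  have hij := congrFun (congrFun hφ i) j
  simp only [conjTranspose_apply, diagonal_mul, Matrix.neg_apply, star_def, map_mul, conj_ofReal] at hij
  -- `hij : t_j * conj (φ j i) = -(t_i * φ i j)`
  simp only [conjTranspose_apply, mul_diagonal, diagonal_mul, star_def, map_mul, conj_ofReal, conj_I]
  have hti : (t i : ℂ) ≠ 0 := by
    rw [← ht i]; push_cast
    exact mul_ne_zero (mul_ne_zero (mul_ne_zero two_ne_zero (fun h => by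
      have := he i; rw [show e i = 0 from by exact_mod_cast h, mul_zero] at this; exact zero_ne_one this))
      (ofReal_ne_zero.2 (hd i))) (ofReal_ne_zero.2 (hd i))
  have htj : (t j : ℂ) ≠ 0 := by
    rw [← ht j]; push_cast
    exact mul_ne_zero (mul_ne_zero (mul_ne_zero two_ne_zero (fun h => by
      have := he j; rw [show e j = 0 from by exact_mod_cast h, mul_zero] at this; exact zero_ne_one this))
      (ofReal_ne_zero.2 (hd j))) (ofReal_ne_zero.2 (hd j))
  have hconj : (starRingEnd ℂ) (φ j i) = -((t i : ℂ) * φ i j) / (t j : ℂ) := by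
    rw [eq_div_iff htj, mul_comm, hij]
  rw [hconj, ← ht i, ← ht j]
  have hdi : (d i : ℂ) ≠ 0 := ofReal_ne_zero.2 (hd i)
  have hdj : (d j : ℂ) ≠ 0 := ofReal_ne_zero.2 (hd j)
  have hei : (e i : ℂ) * (e i : ℂ) = 1 := by exact_mod_cast he i
  have hej : (e j : ℂ) * (e j : ℂ) = 1 := by exact_mod_cast he j
  have hei0 : (e i : ℂ) ≠ 0 := fun h => by rw [h, mul_zero] at hei; exact zero_ne_one hei
  have hej0 : (e j : ℂ) ≠ 0 := fun h => by rw [h, mul_zero] at hej; exact zero_ne_one hej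
  push_cast
  field_simp
  linear_combination (φ i j) * hei - (φ i j) * hej

end Letters

/-! ## 4. Unitarity of `u(φ)` ⇔ skewness; every hermitian translation is reached -/

section Unip

/-- **`u(φ) = (1+φ −φ; φ 1−φ)` preserves `Θ ⊕ −Θ` (`Θ` hermitian) iff `(Θφ)ᴴ = −Θφ`.** [cite: Shimura1997, §6.4] -/
theorem unip_conjTranspose_mul_form_mul_iff {Θ : Matrix l l ℂ} (hΘ : Θᴴ = Θ) (φ : Matrix l l ℂ) :
    (fromBlocks (1 + φ) (-φ) φ (1 - φ))ᴴ * fromBlocks Θ 0 0 (-Θ) * fromBlocks (1 + φ) (-φ) φ (1 - φ) =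
        fromBlocks Θ 0 0 (-Θ) ↔ (Θ * φ)ᴴ = -(Θ * φ) := by
  have hΘφ : (Θ * φ)ᴴ = φᴴ * Θ := by rw [conjTranspose_mul, hΘ]
  rw [fromBlocks_conjTranspose, fromBlocks_multiply, fromBlocks_multiply, conjTranspose_add, conjTranspose_one,
    conjTranspose_neg, conjTranspose_sub, conjTranspose_one, fromBlocks_inj, hΘφ]
  have e11 : ((1 + φᴴ) * Θ + φᴴ * 0) * (1 + φ) + ((1 + φᴴ) * 0 + φᴴ * -Θ) * φ = Θ + (φᴴ * Θ + Θ * φ) := by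
    noncomm_ring
  have e12 : ((1 + φᴴ) * Θ + φᴴ * 0) * -φ + ((1 + φᴴ) * 0 + φᴴ * -Θ) * (1 - φ) = -(φᴴ * Θ + Θ * φ) := by
    noncomm_ring
  have e21 : (-φᴴ * Θ + (1 - φᴴ) * 0) * (1 + φ) + (-φᴴ * 0 + (1 - φᴴ) * -Θ) * φ = -(φᴴ * Θ + Θ * φ) := by
    noncomm_ring
  have e22 : (-φᴴ * Θ + (1 - φᴴ) * 0) * -φ + (-φᴴ * 0 + (1 - φᴴ) * -Θ) * (1 - φ) = -Θ + (φᴴ * Θ + Θ * φ) := by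
    noncomm_ring
  rw [e11, e12, e21, e22]
  constructor
  · rintro ⟨h1, -, -, -⟩
    rw [add_eq_left] at h1
    exact eq_neg_of_add_eq_zero_left h1
  · intro h
    have h0 : φᴴ * Θ + Θ * φ = 0 := by rw [h, neg_add_cancel]
    rw [h0]
    exact ⟨add_zero _, neg_zero, neg_zero, add_zero _⟩

variable (d e : l → ℝ)

/-- **Every hermitian `b` is a transported unipotent**: with `φ_b = D⁻¹ · b · diag(−(2i)⁻¹ e d)`, `D φ_b P₁ = −b/4` (so
`T u(φ_b) T⁻¹ = (1 b; 0 1)` by `conj_unip_eq_transl`). [cite: Shimura1997, §6.4] -/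
theorem frame_phi_of_transl (hd : ∀ i, d i ≠ 0) (he : ∀ i, e i * e i = 1) (b : Matrix l l ℂ) :
    diagonal (fun i => (d i : ℂ)) *
        (diagonal (fun i => (((d i)⁻¹ : ℝ) : ℂ)) * b * diagonal (fun i => -(2 * I)⁻¹ * ((e i * d i : ℝ) : ℂ))) *
      diagonal (fun i => I * (((d i)⁻¹ * e i / 2 : ℝ) : ℂ)) = -(4 : ℂ)⁻¹ • b := by
  ext i j
  simp only [mul_diagonal, diagonal_mul, Matrix.smul_apply, smul_eq_mul]
  have hdi : (d i : ℂ) ≠ 0 := ofReal_ne_zero.2 (hd i)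
  have hdj : (d j : ℂ) ≠ 0 := ofReal_ne_zero.2 (hd j)
  have hej : (e j : ℂ) * (e j : ℂ) = 1 := by exact_mod_cast he j
  have key : (d i : ℂ) * ((((d i)⁻¹ : ℝ) : ℂ) * b i j * (-(2 * I)⁻¹ * ((e j * d j : ℝ) : ℂ))) *
      (I * (((d j)⁻¹ * e j / 2 : ℝ) : ℂ)) =
      -(((d i : ℂ) * (d i : ℂ)⁻¹) * ((d j : ℂ) * (d j : ℂ)⁻¹) * ((e j : ℂ) * (e j : ℂ)) * ((2 * I)⁻¹ * I / 2)) * b i j := by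
    push_cast; ring
  rw [key, mul_inv_cancel₀ hdi, mul_inv_cancel₀ hdj, hej, mul_inv, mul_assoc (2 : ℂ)⁻¹, inv_mul_cancel₀ I_ne_zero]
  norm_num

/-- The `φ_b` of a HERMITIAN `b` satisfies the skewness condition `(diag(t) φ_b)ᴴ = −diag(t) φ_b`, `t = 2 e d²`.
[cite: Shimura1997, §6.4] -/
theorem skew_phi_of_transl (hd : ∀ i, d i ≠ 0) (he : ∀ i, e i * e i = 1) (t : l → ℝ)
    (ht : ∀ i, 2 * e i * d i * d i = t i) {b : Matrix l l ℂ} (hb : bᴴ = b) :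
    (diagonal (fun i => (t i : ℂ)) *
        (diagonal (fun i => (((d i)⁻¹ : ℝ) : ℂ)) * b * diagonal (fun i => -(2 * I)⁻¹ * ((e i * d i : ℝ) : ℂ))))ᴴ =
      -(diagonal (fun i => (t i : ℂ)) *
        (diagonal (fun i => (((d i)⁻¹ : ℝ) : ℂ)) * b * diagonal (fun i => -(2 * I)⁻¹ * ((e i * d i : ℝ) : ℂ)))) := by
  ext i j
  have hbij : (starRingEnd ℂ) (b j i) = b i j := by
    have := congrFun (congrFun hb i) j
    rwa [conjTranspose_apply, star_def] at this
  simp only [conjTranspose_apply, Matrix.neg_apply, mul_diagonal, diagonal_mul, star_def, map_mul, map_neg, map_inv₀,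
    map_ofNat, conj_I, conj_ofReal, hbij]
  rw [← ht i, ← ht j]
  have hdi : (d i : ℂ) ≠ 0 := ofReal_ne_zero.2 (hd i)
  have hdj : (d j : ℂ) ≠ 0 := ofReal_ne_zero.2 (hd j)
  have hei : (e i : ℂ) * (e i : ℂ) = 1 := by exact_mod_cast he i
  have hej : (e j : ℂ) * (e j : ℂ) = 1 := by exact_mod_cast he j
  push_cast
  field_simp

end Unip

/-! ## 5. The package -/

omit [Fintype l] [DecidableEq l] in
/-- The letters of `t`: `d = √(|t|/2) ≠ 0`, `e = t/|t|` with `e² = 1`, and `2 e d² = t`. [folklore] -/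
theorem letters_of (t : l → ℝ) (ht : ∀ i, t i ≠ 0) (i : l) :
    Real.sqrt (|t i| / 2) ≠ 0 ∧ t i / |t i| * (t i / |t i|) = 1 ∧
      2 * (t i / |t i|) * Real.sqrt (|t i| / 2) * Real.sqrt (|t i| / 2) = t i := by
  have ha : |t i| ≠ 0 := abs_ne_zero.2 (ht i)
  have hs : Real.sqrt (|t i| / 2) * Real.sqrt (|t i| / 2) = |t i| / 2 := Real.mul_self_sqrt (by positivity)
  refine ⟨(Real.sqrt_pos.2 (by positivity)).ne', ?_, ?_⟩
  · field_simp
    rw [sq_abs]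
  · rw [mul_assoc (2 * (t i / |t i|)), hs]
    field_simp

/-- **THE FRAME PACKAGE (H1-C, ring level).**  For real nowhere-zero `t` there are `T, T⁻¹ ∈ M_{2l}(ℂ)` with `T T⁻¹ = 1 = T⁻¹ T`,
`Tᴴ (i·J) T = diag(t) ⊕ −diag(t)` (so `g ↦ T g T⁻¹ : U(diag t ⊕ −diag t) → U(J)`, `conj_mem_UJ`), carrying every `Δ`-preserving `g`
(`g₁₁ + g₁₂ = g₂₁ + g₂₂`) to `{C = 0}`, every `u(φ)` to the translation by `b_φ`, which is hermitian when `u(φ)` is unitary, and reaching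
EVERY hermitian `b` from a unitary `u(φ)`. [cite: Shimura1997, §§5–6] -/
theorem exists_tubeFrame (t : l → ℝ) (ht : ∀ i, t i ≠ 0) :
    ∃ T Tinv : Matrix (l ⊕ l) (l ⊕ l) ℂ, T * Tinv = 1 ∧ Tinv * T = 1 ∧
      Tᴴ * (I • Matrix.J l ℂ) * T = fromBlocks (diagonal fun i => (t i : ℂ)) 0 0 (-diagonal fun i => (t i : ℂ)) ∧
      (∀ g : Matrix (l ⊕ l) (l ⊕ l) ℂ, g.toBlocks₁₁ + g.toBlocks₁₂ = g.toBlocks₂₁ + g.toBlocks₂₂ →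
        (T * g * Tinv).toBlocks₂₁ = 0) ∧
      (∀ φ : Matrix l l ℂ, ∃ b : Matrix l l ℂ, T * fromBlocks (1 + φ) (-φ) φ (1 - φ) * Tinv = fromBlocks 1 b 0 1 ∧
        ((diagonal (fun i => (t i : ℂ)) * φ)ᴴ = -(diagonal (fun i => (t i : ℂ)) * φ) → bᴴ = b)) ∧
      (∀ b : Matrix l l ℂ, bᴴ = b → ∃ φ : Matrix l l ℂ, (diagonal (fun i => (t i : ℂ)) * φ)ᴴ = -(diagonal (fun i => (t i : ℂ)) * φ) ∧
        T * fromBlocks (1 + φ) (-φ) φ (1 - φ) * Tinv = fromBlocks 1 b 0 1) := by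
  -- the letters
  have hd : ∀ i, Real.sqrt (|t i| / 2) ≠ 0 := fun i => (letters_of t ht i).1
  have he : ∀ i, t i / |t i| * (t i / |t i|) = 1 := fun i => (letters_of t ht i).2.1
  have ht' : ∀ i, 2 * (t i / |t i|) * Real.sqrt (|t i| / 2) * Real.sqrt (|t i| / 2) = t i := fun i => (letters_of t ht i).2.2
  have R1 := letters_R1 (fun i => Real.sqrt (|t i| / 2)) hd
  have R2 := letters_R2 (fun i => Real.sqrt (|t i| / 2)) (fun i => t i / |t i|) hd he
  have R3 := letters_R3 (fun i => Real.sqrt (|t i| / 2)) (fun i => t i / |t i|) hd he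
  have R4 := letters_R4 (fun i => Real.sqrt (|t i| / 2)) (fun i => t i / |t i|) hd he
  refine ⟨_, _, frame_mul_frameInv R1 R2, frameInv_mul_frame R3 R4,
    frame_conjTranspose_mul_smul_J_mul _ _ t ht', fun g hg => toBlocks₂₁_conj_eq_zero_of_siegel _ _ _ _ hg,
    fun φ => ⟨_, conj_unip_eq_transl R1 R2 φ, fun hφ => ?_⟩, fun b hb => ⟨_, skew_phi_of_transl _ _ hd he t ht' hb, ?_⟩⟩
  · have h := conjTranspose_transl_of_skew (fun i => Real.sqrt (|t i| / 2)) (fun i => t i / |t i|) hd he t ht' hφ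
    simp only [conjTranspose_neg, conjTranspose_add, h]
  · rw [conj_unip_eq_transl R1 R2, frame_phi_of_transl _ _ hd he]
    congr 1
    rw [← add_smul, ← add_smul, ← neg_smul]
    norm_num

end Summit.HodgeConjecture.HodgeConjecture.Cruxes.HLiu418.K2LiuHermitianTubeFrame
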